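import Summits.QuantumAdvantage.QuantumAdvantage.Theorems.RingFrameRingToElimStubs
import Summits.QuantumAdvantage.AdviceFreeQNC0.BlindWindowPolylog
import HarnessLib

/-!
# Route RingFrame, crux α `RingToElim` (stmt-QuantumAdvantage-19119): α IS ITS SIGHTED CASE —
# hardness for strategies that READ every polylog window from inside gives `RingHardU`, `RingToElim`

The blind-window theorem (`ringWinU_blindWindow_le`, `AdviceFreeQNC0/BlindWindowPolylog.lean`):
there is `θ₂ < 1` such that for every `C` and all large `n`, a walk strategy of degree
`≤ (log₂ n)^C` whose selectors strictly inside some window `(p, p + ℓ)` of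
`ℓ = 2(log₂ n)^{2C+1}` input bits depend only on the bits OUTSIDE the window — dense, blind bets
allowed — wins the ring game in walk coordinates on at most `θ₂·2ⁿ` inputs.  Hence the crux
`RingHardU` (all polylog-degree walk strategies) follows from its restriction to SIGHTED
strategies — those having, inside every such window with `p + ℓ ≤ n`, a position whose selector
distinguishes two inputs that agree outside the window:

* `ringHardU_of_sightedHard` — sighted hardness (hypothesis stated inline, the shape of
  `RingHardU` with the sightedness premise added) `→ RingHardU`;
* `ringHard_two_of_sightedHard`, `ringToElim_of_sightedHard` — then `RingHard 2`
  (`stub_transport`) and the crux `RingToElim` BY NAME.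

This strictly refines `ringToElim_of_denseHard` (a sighted strategy is dense: a selector that
reads the window is not identically false).  The cell's statement (prover qn-prover-3); not in
print.  WHAT THIS IS NOT: sighted hardness is NOT proved (it is α proper: e.g. the canonical
selectors `y_g(u) = u_{g−1} ⊕ u_g`-type local rules read every window); conditional results
credit nothing; no separation.
-/

-- the sub-problem namespace `Summit.QuantumAdvantage.QuantumAdvantage` repeats the summit name by design (D-0017)
set_option linter.dupNamespace false

noncomputable section

namespace Summit.QuantumAdvantage.QuantumAdvantage.Theorems

open Finset Summit.QuantumAdvantage.AdviceFreeQNC0 RingToElim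
open Literature.Computability.MetaComplexity Literature.Computability.MetaComplexity.Smolensky

/-- **α is its sighted case.**  If there is `θ < 1` such that for every `C` and all large `n`
every SIGHTED walk strategy of degree `≤ (log₂ n)^C` — inside every window
`(p, p + 2(log₂ n)^{2C+1})` with `p + 2(log₂ n)^{2C+1} ≤ n` some position's selector takes
different values on two inputs agreeing outside the window — wins the ring game at charge
`n + 2` on at most `θ·2ⁿ` inputs, then `RingHardU` (all strategies): a non-sighted strategy has a
blind window and the blind-window theorem `ringWinU_blindWindow_le` bounds it.
(Cell statement; conditional on the sighted hypothesis.) -/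
theorem ringHardU_of_sightedHard
    (h : ∃ θ : ℝ, θ < 1 ∧ ∀ C : ℕ, ∃ n₀ : ℕ, ∀ n ≥ n₀, ∀ y : Fin (n + 1) → (Fin n → Bool) → Bool,
      (∀ g, HasDeg (y g) ((Nat.log 2 n) ^ C)) →
      (∀ p : ℕ, p + 2 * (Nat.log 2 n) ^ (2 * C + 1) ≤ n →
        ∃ g : Fin (n + 1), p < g.val ∧ g.val < p + 2 * (Nat.log 2 n) ^ (2 * C + 1) ∧
          ∃ u u' : Fin n → Bool,
            (∀ i : Fin n, i.val < p ∨ p + 2 * (Nat.log 2 n) ^ (2 * C + 1) ≤ i.val → u i = u' i) ∧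
            y g u ≠ y g u') →
        ((univ.filter fun u : Fin n → Bool => ringWinU (n + 2) y u = true).card : ℝ) ≤
          θ * (2 : ℝ) ^ n) :
    RingHardU := by
  obtain ⟨θ₁, hθ₁, h₁⟩ := h
  obtain ⟨θ₂, hθ₂, h₂⟩ := ringWinU_blindWindow_le
  refine ⟨max θ₁ θ₂, max_lt hθ₁ hθ₂, fun C => ?_⟩
  obtain ⟨n₁, hn₁⟩ := h₁ C
  obtain ⟨n₂, hn₂⟩ := h₂ C
  refine ⟨max n₁ n₂, fun n hn y hdeg => ?_⟩
  have hn₁n : n₁ ≤ n := le_trans (le_max_left _ _) hn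
  have hn₂n : n₂ ≤ n := le_trans (le_max_right _ _) hn
  have hpow : (0 : ℝ) ≤ (2 : ℝ) ^ n := by positivity
  by_cases hsighted : ∀ p : ℕ, p + 2 * (Nat.log 2 n) ^ (2 * C + 1) ≤ n →
      ∃ g : Fin (n + 1), p < g.val ∧ g.val < p + 2 * (Nat.log 2 n) ^ (2 * C + 1) ∧
        ∃ u u' : Fin n → Bool,
          (∀ i : Fin n, i.val < p ∨ p + 2 * (Nat.log 2 n) ^ (2 * C + 1) ≤ i.val → u i = u' i) ∧
          y g u ≠ y g u'
  · -- sighted: the hypothesis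
    calc ((univ.filter fun u : Fin n → Bool => ringWinU (n + 2) y u = true).card : ℝ)
        ≤ θ₁ * (2 : ℝ) ^ n := hn₁ n hn₁n y hdeg hsighted
      _ ≤ max θ₁ θ₂ * (2 : ℝ) ^ n := mul_le_mul_of_nonneg_right (le_max_left _ _) hpow
  · -- not sighted: a blind window, the blind-window theorem
    push Not at hsighted
    obtain ⟨p, hp, hblind⟩ := hsighted
    calc ((univ.filter fun u : Fin n → Bool => ringWinU (n + 2) y u = true).card : ℝ)
        ≤ θ₂ * (2 : ℝ) ^ n := hn₂ n hn₂n p _ hp le_rfl (n + 2) y hdeg hblind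
      _ ≤ max θ₁ θ₂ * (2 : ℝ) ^ n := mul_le_mul_of_nonneg_right (le_max_right _ _) hpow

/-- **Sighted hardness gives the rung statement `RingHard 2`** (through `stub_transport`). -/
theorem ringHard_two_of_sightedHard
    (h : ∃ θ : ℝ, θ < 1 ∧ ∀ C : ℕ, ∃ n₀ : ℕ, ∀ n ≥ n₀, ∀ y : Fin (n + 1) → (Fin n → Bool) → Bool,
      (∀ g, HasDeg (y g) ((Nat.log 2 n) ^ C)) →
      (∀ p : ℕ, p + 2 * (Nat.log 2 n) ^ (2 * C + 1) ≤ n →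
        ∃ g : Fin (n + 1), p < g.val ∧ g.val < p + 2 * (Nat.log 2 n) ^ (2 * C + 1) ∧
          ∃ u u' : Fin n → Bool,
            (∀ i : Fin n, i.val < p ∨ p + 2 * (Nat.log 2 n) ^ (2 * C + 1) ≤ i.val → u i = u' i) ∧
            y g u ≠ y g u') →
        ((univ.filter fun u : Fin n → Bool => ringWinU (n + 2) y u = true).card : ℝ) ≤
          θ * (2 : ℝ) ^ n) :
    Summit.QuantumAdvantage.AdviceFreeQNC0.RingHard 2 :=
  stub_transport (ringHardU_of_sightedHard h)

/-- **Sighted hardness gives the crux α `RingToElim` by name** (its antecedent `ElimHard` is not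
even needed: it is a theorem, `elimHard_holds`). -/
theorem ringToElim_of_sightedHard
    (h : ∃ θ : ℝ, θ < 1 ∧ ∀ C : ℕ, ∃ n₀ : ℕ, ∀ n ≥ n₀, ∀ y : Fin (n + 1) → (Fin n → Bool) → Bool,
      (∀ g, HasDeg (y g) ((Nat.log 2 n) ^ C)) →
      (∀ p : ℕ, p + 2 * (Nat.log 2 n) ^ (2 * C + 1) ≤ n →
        ∃ g : Fin (n + 1), p < g.val ∧ g.val < p + 2 * (Nat.log 2 n) ^ (2 * C + 1) ∧
          ∃ u u' : Fin n → Bool,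
            (∀ i : Fin n, i.val < p ∨ p + 2 * (Nat.log 2 n) ^ (2 * C + 1) ≤ i.val → u i = u' i) ∧
            y g u ≠ y g u') →
        ((univ.filter fun u : Fin n → Bool => ringWinU (n + 2) y u = true).card : ℝ) ≤
          θ * (2 : ℝ) ^ n) :
    Summit.QuantumAdvantage.QuantumAdvantage.Theses.RingFrame.RingToElim :=
  fun _ => ringHard_two_of_sightedHard h

end Summit.QuantumAdvantage.QuantumAdvantage.Theorems
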